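import Literature.AlgebraicGeometry.Deligne1982.WeilTypeGeneralMemberPowersExceptionalClasses
import Literature.AlgebraicGeometry.Milne1999.SpecialLefschetzGroupInvariantsHolds
import HarnessLib

/-!
# The Lefschetz group of the general CM-Weil abelian variety: `Hg(A)|_{H¹} = SU(φ) ⊊ U(φ) = S(A)`, `Hg′(A) ⊊ S(A)`, `Hg(A) ⊊ L(A)`

Milne [Milne2025AbelianMotivesCharP, §1.5 Example 1.17]: for a general polarized abelian variety `(A, ν, λ)` of Weil type
relative to a CM field `E` (`φ` the `E`-hermitian form of the polarization) «there is an exact commutative diagram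
`SU(φ) ↪ MT(A)`, `GU(φ) ↪ L(A)` … It follows that for a general `A`, the Weil classes are Hodge classes but not Lefschetz
classes». Milne [Milne1999LefschetzClasses, §4]: `L(A)` is the largest subgroup fixing the Lefschetz classes on all powers
(Def. 4.3), `≅ G(A)` = the centraliser of `End⁰(A)` in the group of similitudes of the polarization (Thm. 4.4), its kernel
`S(A)` the centraliser of `End⁰(A)` in the unitary group of the polarization (§1 p. 644); Prop. 4.8: «(a) no power of `A`
supports an exotic Hodge class; (b) `Hg(A) = L(A)`; (c) `Hg′(A) = S(A)` are equivalent».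

This file proves, on the tree's carriers, for `(A, η, h)` of Weil type relative to `E = ℚ(η)` (`IsWeilTypeCM A η R e₀ k`,
`h` a polarization class with the Rosati condition):
* `SU(φ)(ℂ) ⊊ U(φ)(ℂ)` (`k ≥ 1`: a diagonal element of `U(φ)(ℂ)` with determinant `2^{2k}` on a block `W_β`);
* for the GENERAL member (`Hg(A) = SU(φ)`, tree `HasHodgeGroupSUCM`) with `k ≥ 2`: Milne's `S(A)(ℂ)` read on `H¹`
  (tree `Milne1999.unitaryCentralizerGroup A h`: commute with every `ψ^*`, `ψ ∈ End(A)`, and preserve `Q_h`) EQUALS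
  `U(φ)(ℂ)` (every `ψ^*` is a polynomial in `η^*`, tree `exists_pullbackOne_eq_aeval_of_hasHodgeGroupSUCM`, i.e.
  `End⁰(A) = E`), so `Hg(A)(ℂ)|_{H¹} = SU(φ)(ℂ) ⊊ S(A)(ℂ)` — the gap of Milne's diagram;
* Milne's Prop. 4.8 fails for the general member: `Hg′(A) ⊊ S(A)` and `Hg(A) ⊊ L(A)` as subgroups of
  `∏ₖ GL(Hᵏ(A(ℂ); ℂ))` (tree `hodgeGroup`, `specialLefschetzGroup`, `mumfordTateGroup`, `lefschetzGroup`; via the PROVED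
  record `Milne1999_specialLefschetzGroup_invariants_le_holds` = Cor. 4.5 and `B(A) ≠ D(A)`, tree
  `IsWeilTypeCM.not_isDivisorGenerated_of_hodgeGroupSU`), also for every power `A^{N+1}` and for everything isogenous to
  `A`; and the same four statements for van Geemen's general member (`K` imaginary quadratic, `Hg = SU_H`, `n ≥ 2`;
  the tree had `Hg|_{H¹} ⊊ S(A)(ℂ)|_{H¹}` there, `VanGeemen1994.hodgeGroupOne_lt_unitaryCentralizerGroup_of_hasHodgeGroupSU`).

All `theorem`s; no definition, no named fact.

## References

* [Milne2025AbelianMotivesCharP] J. S. Milne, *Abelian motives in characteristic p*, arXiv:2508.09972, §1.5 Example 1.17.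
* [Milne1999LefschetzClasses] J. S. Milne, *Lefschetz classes on abelian varieties*, Duke Math. J. 96 (1999), §1 p. 644
  (`S(A)`), §4 Def. 4.3, Thm. 4.4, Cor. 4.5, Prop. 4.8 (p. 660).
* [Deligne1982HodgeCycles] P. Deligne (notes by J. S. Milne), LNM 900 (1982), §4; Milne's 2003 re-edition, endnote 16.
* [vanGeemen1994HodgeAV] B. van Geemen, LNM 1594 (1994), 6.9, Lemma 6.10, Thm. 6.11–6.12.
-/

noncomputable section

open CategoryTheory Polynomial
open Literature.AlgebraicTopology.SingularHomology
open Literature.AlgebraicGeometry.Motives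
open Literature.AlgebraicGeometry.HodgeTheory
open Literature.AlgebraicGeometry.VanGeemen1994
open Literature.AlgebraicGeometry.Milne1999

namespace Literature.AlgebraicGeometry.Deligne1982

variable {A : AbelianVariety ℂ} {η : A ⟶ A} {R : Polynomial ℤ} {e₀ k : ℕ} {h : complexBetti A.X 2}

/-! ### §1 `SU(φ)(ℂ) ⊊ U(φ)(ℂ)` -/

section UnitaryGroups

variable (hW : IsWeilTypeCM A η R e₀ k) (hpol : IsPolarizationClass A.dim A.X h) (hRos : IsRosatiCM A η h)

include hW in
/-- `τ_β` is a root of `P_R`. [cite: Deligne1982HodgeCycles, §4 p. 30] -/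
private theorem IsWeilTypeCM.eval₂_cmEmb_eq_zero (β : Fin (cmDeg R)) :
    Polynomial.eval₂ (Int.castRingHom ℂ) (cmEmb R β) (R.comp (X ^ 2)) = 0 := by
  classical
  have hmem : cmEmb R β ∈ cmType R := ((cmType R).equivFin.symm β).2
  have hroot : cmEmb R β ∈ cmRoots R := (Finset.mem_filter.1 hmem).1
  rw [cmRoots, Multiset.mem_toFinset, Polynomial.mem_roots (hW.monic_comp.map (Int.castRingHom ℂ)).ne_zero,
    Polynomial.IsRoot, Polynomial.eval_map] at hroot
  exact hroot

include hW hpol hRos in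
/-- **An element of `U(φ)(ℂ)` with determinant `2^{2k}` on the block `W_β`**: the diagonal automorphism `w^β_i ↦ 2 w^β_i`,
`w*^β_i ↦ w*^β_i / 2`, identity on the other blocks (tree `monoAutoCM`; it commutes with `η^*` and preserves `Q_h`).
[cite: vanGeemen1994HodgeAV, 6.9 and Lemma 6.10] [cite: Milne2025AbelianMotivesCharP, §1.5 Example 1.17] -/
theorem IsWeilTypeCM.exists_mem_weilUnitaryGroupCM_detOnEigenspace_eq (β : Fin (cmDeg R)) :
    ∃ u ∈ weilUnitaryGroupCM A η h, ∃ hc : ∀ x, u (pullbackOne A η x) = pullbackOne A η (u x),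
      detOnEigenspace u (pullbackOne A η) hc (cmEmb R β) = 2 ^ (2 * k) := by
  classical
  let c : Fin (cmDeg R) × (Fin (2 * k) × Fin 2) → ℂˣ := fun p =>
    if p.1 = β then (if p.2.2 = 0 then twoU else twoU⁻¹) else 1
  have hc : ∀ β' i, (c (β', i, 0) : ℂ) * c (β', i, 1) = 1 := by
    intro β' i
    by_cases hβ : β' = β
    · simp [c, hβ]
    · simp [c, hβ]
  refine ⟨monoAutoCM hW hpol hRos (blockPermCM β 1) c, monoAutoCM_mem_weilUnitaryGroupCM hW hpol hRos β 1 c hc,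
    monoAutoCM_comm hW hpol hRos β 1 c, ?_⟩
  rw [detOnEigenspace_monoAutoCM_zero hW hpol hRos β 1 c β]
  simp [c, twoU, Finset.prod_const, Finset.card_univ, Fintype.card_fin]

include hW hpol hRos in
/-- **`SU(φ)(ℂ) ≠ U(φ)(ℂ)`** (`k ≥ 1`): the element above has determinant `2^{2k} ≠ 1` on `W_β`.
[cite: vanGeemen1994HodgeAV, 6.9 and Lemma 6.10] [cite: Milne2025AbelianMotivesCharP, §1.5 Example 1.17] -/
theorem IsWeilTypeCM.weilSpecialUnitaryGroupCM_ne_weilUnitaryGroupCM :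
    weilSpecialUnitaryGroupCM A η (R.comp (X ^ 2)) h ≠ weilUnitaryGroupCM A η h := by
  intro heq
  set β : Fin (cmDeg R) := ⟨0, hW.cmDeg_pos⟩
  obtain ⟨u, hu, hc, hdet⟩ := hW.exists_mem_weilUnitaryGroupCM_detOnEigenspace_eq hpol hRos β
  rw [← heq] at hu
  obtain ⟨hc', -, hdet'⟩ := hu
  have h1 := hdet' (cmEmb R β) (hW.eval₂_cmEmb_eq_zero β)
  have hk := hW.k_pos
  have h2 : (2 : ℂ) ^ (2 * k) ≠ 1 := by
    have h' : (2 : ℕ) ^ (2 * k) ≠ 1 := (Nat.one_lt_two_pow (by omega)).ne'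
    exact_mod_cast h'
  exact h2 (hdet ▸ h1)

include hW hpol hRos in
/-- **`SU(φ)(ℂ) ⊊ U(φ)(ℂ)`** (`k ≥ 1`). [cite: vanGeemen1994HodgeAV, 6.9 and Lemma 6.10] [cite: Milne2025AbelianMotivesCharP, §1.5 Example 1.17] -/
theorem IsWeilTypeCM.weilSpecialUnitaryGroupCM_lt_weilUnitaryGroupCM :
    weilSpecialUnitaryGroupCM A η (R.comp (X ^ 2)) h < weilUnitaryGroupCM A η h :=
  lt_of_le_of_ne (weilSpecialUnitaryGroupCM_le_weilUnitaryGroupCM A η _ h)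
    (hW.weilSpecialUnitaryGroupCM_ne_weilUnitaryGroupCM hpol hRos)

end UnitaryGroups

/-! ### §2 Milne's `S(A)(ℂ)` on `H¹` versus `U(φ)(ℂ)` -/

section Centralizer

/-- **`S(A)(h)(ℂ) ≤ U(φ)(ℂ)` always** (`η ∈ End(A)`: `S(A)` centralises all of `End(A)` and preserves `Q_h`).
[cite: Milne1999LefschetzClasses, §1 p. 644] [cite: Deligne1982HodgeCycles, Milne 2003 re-edition endnote 16] -/
theorem unitaryCentralizerGroup_le_weilUnitaryGroupCM (η : A ⟶ A) (h : complexBetti A.X 2) :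
    unitaryCentralizerGroup A h ≤ weilUnitaryGroupCM A η h := by
  rintro u ⟨hc, hQ⟩
  exact ⟨fun x ↦ mem_centralizerGroup_iff.1 hc η x, hQ⟩

/-- Commuting with `y` implies commuting with every polynomial in `y`. [folklore] -/
private theorem commute_aeval_of_commute' {M : Type*} [AddCommGroup M] [Module ℂ M] {x y : Module.End ℂ M}
    (hxy : Commute x y) (p : ℂ[X]) : Commute x (aeval y p) := by
  rw [aeval_eq_sum_range]
  exact Commute.sum_right _ _ _ fun j _ ↦ (hxy.pow_right j).smul_right _

variable (hW : IsWeilTypeCM A η R e₀ k) (hpol : IsPolarizationClass A.dim A.X h) (hRos : IsRosatiCM A η h)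

include hW hpol hRos in
/-- **`U(φ)(ℂ) ≤ S(A)(h)(ℂ)` for the general member** (`Hg(A) = SU(φ)`, `k ≥ 2`): an automorphism commuting with `η^*`
commutes with every `ψ^*`, `ψ ∈ End(A)`, because `ψ^* = Q(η^*)` is a polynomial in `η^*` (tree
`exists_pullbackOne_eq_aeval_of_hasHodgeGroupSUCM`: `End⁰(A) = E = ℚ(η)` for the general member — Milne's `L(A) = GU(φ)`).
[cite: Milne2025AbelianMotivesCharP, §1.5 Example 1.17] [cite: Milne1999LefschetzClasses, §1 p. 644 and Thm. 4.4] -/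
theorem IsWeilTypeCM.weilUnitaryGroupCM_le_unitaryCentralizerGroup_of_hodgeGroupSU (hk : 2 ≤ k)
    (hSU : HasHodgeGroupSUCM A η (R.comp (X ^ 2)) h) : weilUnitaryGroupCM A η h ≤ unitaryCentralizerGroup A h := by
  rintro u ⟨hc, hQ⟩
  refine ⟨mem_centralizerGroup_iff.2 fun ψ x ↦ ?_, hQ⟩
  obtain ⟨Q, hQψ⟩ := exists_pullbackOne_eq_aeval_of_hasHodgeGroupSUCM hW hpol hRos hSU hk ψ
  have hcomm : Commute (u : Module.End ℂ (complexBetti A.X 1)) (pullbackOne A η) :=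
    LinearMap.ext fun y ↦ hc y
  have h2 := LinearMap.congr_fun (commute_aeval_of_commute' hcomm Q).eq x
  rw [hQψ]
  simpa only [Module.End.mul_apply, LinearEquiv.coe_coe] using h2

include hW hpol hRos in
/-- **`S(A)(h)(ℂ) = U(φ)(ℂ)` FOR THE GENERAL CM-WEIL ABELIAN VARIETY** (`Hg(A) = SU(φ)`, `k ≥ 2`): Milne's special
Lefschetz group (the centraliser of `End⁰(A) = E` in the unitary group of the polarization), read on `H¹(A(ℂ); ℂ)`, is the
unitary group `U(φ)(ℂ)` — the bottom row `GU(φ) ≅ L(A)` of Milne's diagram, in its kernel form.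
[cite: Milne2025AbelianMotivesCharP, §1.5 Example 1.17] [cite: Milne1999LefschetzClasses, §1 p. 644, Thm. 4.4] -/
theorem IsWeilTypeCM.unitaryCentralizerGroup_eq_weilUnitaryGroupCM_of_hodgeGroupSU (hk : 2 ≤ k)
    (hSU : HasHodgeGroupSUCM A η (R.comp (X ^ 2)) h) : unitaryCentralizerGroup A h = weilUnitaryGroupCM A η h :=
  le_antisymm (unitaryCentralizerGroup_le_weilUnitaryGroupCM η h)
    (hW.weilUnitaryGroupCM_le_unitaryCentralizerGroup_of_hodgeGroupSU hpol hRos hk hSU)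

/-! ### §3 `Hg|_{H¹} ⊊ S(A)|_{H¹}`, `Hg′(A) ⊊ S(A)`, `Hg(A) ⊊ L(A)` for the general member -/

include hW hpol hRos in
/-- **`Hg(A)(ℂ)|_{H¹} = SU(φ)(ℂ) ⊊ U(φ)(ℂ) = S(A)(h)(ℂ)` FOR THE GENERAL CM-WEIL ABELIAN VARIETY** (`k ≥ 2`) — the top row
`SU(φ) ↪ MT(A)` sits strictly inside the bottom row `GU(φ) ↪ L(A)` of Milne's diagram.
[cite: Milne2025AbelianMotivesCharP, §1.5 Example 1.17] [cite: Milne1999LefschetzClasses, §1 p. 644, Thm. 4.4 and Prop. 4.8] -/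
theorem IsWeilTypeCM.hodgeGroupOne_lt_unitaryCentralizerGroup_of_hodgeGroupSU (hk : 2 ≤ k)
    (hSU : HasHodgeGroupSUCM A η (R.comp (X ^ 2)) h) : hodgeGroupOne A.dim A.X < unitaryCentralizerGroup A h := by
  rw [hW.unitaryCentralizerGroup_eq_weilUnitaryGroupCM_of_hodgeGroupSU hpol hRos hk hSU, hasHodgeGroupSUCM_iff.1 hSU]
  exact hW.weilSpecialUnitaryGroupCM_lt_weilUnitaryGroupCM hpol hRos

include hW hpol hRos in
/-- … in particular `Hg(A)(ℂ)|_{H¹} ≠ S(A)(h)(ℂ)`. [cite: Milne2025AbelianMotivesCharP, §1.5 Example 1.17]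
[cite: Milne1999LefschetzClasses, Prop. 4.8] -/
theorem IsWeilTypeCM.hodgeGroupOne_ne_unitaryCentralizerGroup_of_hodgeGroupSU (hk : 2 ≤ k)
    (hSU : HasHodgeGroupSUCM A η (R.comp (X ^ 2)) h) : hodgeGroupOne A.dim A.X ≠ unitaryCentralizerGroup A h :=
  (hW.hodgeGroupOne_lt_unitaryCentralizerGroup_of_hodgeGroupSU hpol hRos hk hSU).ne

include hW hpol hRos in
/-- **Milne's Prop. 4.8 (c) FAILS for the general CM-Weil abelian variety: `Hg′(A) ≠ S(A)`** (`k ≥ 2`) — `A` supports an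
exotic Hodge class (tree `IsWeilTypeCM.not_isDivisorGenerated_of_hodgeGroupSU`), while `Hg′(A) = S(A)` would make every
Hodge class a Lefschetz class (Milne's Cor. 4.5, the tree's PROVED record `Milne1999_specialLefschetzGroup_invariants_le_holds`).
[cite: Milne1999LefschetzClasses, Cor. 4.5 and Prop. 4.8 (p. 660)] [cite: Milne2025AbelianMotivesCharP, §1.5 Example 1.17] -/
theorem IsWeilTypeCM.hodgeGroup_ne_specialLefschetzGroup_of_hodgeGroupSU (hk : 2 ≤ k)
    (hSU : HasHodgeGroupSUCM A η (R.comp (X ^ 2)) h) : hodgeGroup A.dim A.X ≠ specialLefschetzGroup A.dim A.X :=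
  AbelianVariety.hodgeGroup_ne_specialLefschetzGroup_of_not_isDivisorGenerated _
    Milne1999_specialLefschetzGroup_invariants_le_holds
    (hW.not_isDivisorGenerated_of_hodgeGroupSU hpol hRos hk hSU)

include hW hpol hRos in
/-- **`Hg′(A) ⊊ S(A)`** for the general CM-Weil abelian variety (`k ≥ 2`; `Hg′ ≤ S` always, Milne p. 660).
[cite: Milne1999LefschetzClasses, §4 p. 660 and Prop. 4.8] [cite: Milne2025AbelianMotivesCharP, §1.5 Example 1.17] -/
theorem IsWeilTypeCM.hodgeGroup_lt_specialLefschetzGroup_of_hodgeGroupSU (hk : 2 ≤ k)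
    (hSU : HasHodgeGroupSUCM A η (R.comp (X ^ 2)) h) : hodgeGroup A.dim A.X < specialLefschetzGroup A.dim A.X :=
  lt_of_le_of_ne (AbelianVariety.hodgeGroup_le_specialLefschetzGroup A).1
    (hW.hodgeGroup_ne_specialLefschetzGroup_of_hodgeGroupSU hpol hRos hk hSU)

include hW hpol hRos in
/-- **Milne's Prop. 4.8 (b) FAILS for the general CM-Weil abelian variety: `Hg(A) ≠ L(A)`** (`k ≥ 2`; Milne's
`GL × 𝔾_m`-convention, the tree's `mumfordTateGroup` / `lefschetzGroup`; (b) ⟺ (c), tree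
`AbelianVariety.hodgeGroup_eq_specialLefschetzGroup_iff`). [cite: Milne1999LefschetzClasses, Prop. 4.8 (p. 660)]
[cite: Milne2025AbelianMotivesCharP, §1.5 Example 1.17] -/
theorem IsWeilTypeCM.mumfordTateGroup_ne_lefschetzGroup_of_hodgeGroupSU (hk : 2 ≤ k)
    (hSU : HasHodgeGroupSUCM A η (R.comp (X ^ 2)) h) : mumfordTateGroup A.dim A.X ≠ lefschetzGroup A.dim A.X := by
  have hdim : 1 ≤ A.dim := by have := hW.two_le_dim; omega
  exact fun heq ↦ hW.hodgeGroup_ne_specialLefschetzGroup_of_hodgeGroupSU hpol hRos hk hSU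
    ((AbelianVariety.hodgeGroup_eq_specialLefschetzGroup_iff A hdim).2 heq)

include hW hpol hRos in
/-- **`Hg(A) ⊊ L(A)`** for the general CM-Weil abelian variety (`k ≥ 2`). [cite: Milne1999LefschetzClasses, §4 p. 660 and Prop. 4.8]
[cite: Milne2025AbelianMotivesCharP, §1.5 Example 1.17] -/
theorem IsWeilTypeCM.mumfordTateGroup_lt_lefschetzGroup_of_hodgeGroupSU (hk : 2 ≤ k)
    (hSU : HasHodgeGroupSUCM A η (R.comp (X ^ 2)) h) : mumfordTateGroup A.dim A.X < lefschetzGroup A.dim A.X :=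
  lt_of_le_of_ne (AbelianVariety.hodgeGroup_le_specialLefschetzGroup A).2
    (hW.mumfordTateGroup_ne_lefschetzGroup_of_hodgeGroupSU hpol hRos hk hSU)

include hW hpol hRos in
/-- **On every power: `Hg′(A^{N+1}) ≠ S(A^{N+1})`** (every power of the general member carries an exotic Hodge class, tree
`IsWeilTypeCM.not_isDivisorGenerated_powSucc_of_hodgeGroupSU`). [cite: Milne1999LefschetzClasses, Cor. 4.5, Cor. 4.7 and Prop. 4.8]
[cite: Milne2025AbelianMotivesCharP, §1.5 Example 1.17] -/
theorem IsWeilTypeCM.hodgeGroup_powSucc_ne_specialLefschetzGroup_of_hodgeGroupSU (hk : 2 ≤ k)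
    (hSU : HasHodgeGroupSUCM A η (R.comp (X ^ 2)) h) (N : ℕ) :
    hodgeGroup (A.powSucc N).dim (A.powSucc N).X ≠ specialLefschetzGroup (A.powSucc N).dim (A.powSucc N).X :=
  AbelianVariety.hodgeGroup_ne_specialLefschetzGroup_of_not_isDivisorGenerated _
    Milne1999_specialLefschetzGroup_invariants_le_holds
    (hW.not_isDivisorGenerated_powSucc_of_hodgeGroupSU hpol hRos hk hSU N)

/-- **On the isogeny class: `Hg′(C) ≠ S(C)`** for every `C` isogenous to a general CM-Weil member (`k ≥ 2`; `C` carries an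
exotic Hodge class, tree `not_isDivisorGenerated_of_isIsogenous_of_hasHodgeGroupSUCM`).
[cite: Milne1999LefschetzClasses, §1 p. 644 («S(A) depends only on the isogeny class»), Cor. 4.5 and Prop. 4.8]
[cite: vanGeemen1994HodgeAV, 3.6 (p. 236)] -/
theorem hodgeGroup_ne_specialLefschetzGroup_of_isIsogenous_of_hasHodgeGroupSUCM {C : AbelianVariety ℂ}
    (hW : IsWeilTypeCM A η R e₀ k) (hpol : IsPolarizationClass A.dim A.X h) (hRos : IsRosatiCM A η h) (hk : 2 ≤ k)
    (hSU : HasHodgeGroupSUCM A η (R.comp (X ^ 2)) h) (hC : AbelianVariety.IsIsogenous C A) :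
    hodgeGroup C.dim C.X ≠ specialLefschetzGroup C.dim C.X :=
  AbelianVariety.hodgeGroup_ne_specialLefschetzGroup_of_not_isDivisorGenerated _
    Milne1999_specialLefschetzGroup_invariants_le_holds
    (not_isDivisorGenerated_of_isIsogenous_of_hasHodgeGroupSUCM hW hpol hRos hk hSU hC)

/-- **On the isogeny class: `Hg(C) ≠ L(C)`.** [cite: Milne1999LefschetzClasses, Prop. 4.8] [cite: vanGeemen1994HodgeAV, 3.6 (p. 236)] -/
theorem mumfordTateGroup_ne_lefschetzGroup_of_isIsogenous_of_hasHodgeGroupSUCM {C : AbelianVariety ℂ}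
    (hW : IsWeilTypeCM A η R e₀ k) (hpol : IsPolarizationClass A.dim A.X h) (hRos : IsRosatiCM A η h) (hk : 2 ≤ k)
    (hSU : HasHodgeGroupSUCM A η (R.comp (X ^ 2)) h) (hC : AbelianVariety.IsIsogenous C A) :
    mumfordTateGroup C.dim C.X ≠ lefschetzGroup C.dim C.X := by
  have hdim : 1 ≤ C.dim := by
    obtain ⟨g, hg⟩ := hC
    have := hW.two_le_dim
    have hCA : C.dim = A.dim := AbelianVariety.dim_eq_of_isIsogeny hg
    omega
  exact fun heq ↦ hodgeGroup_ne_specialLefschetzGroup_of_isIsogenous_of_hasHodgeGroupSUCM hW hpol hRos hk hSU hC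
    ((AbelianVariety.hodgeGroup_eq_specialLefschetzGroup_iff C hdim).2 heq)

end Centralizer

end Literature.AlgebraicGeometry.Deligne1982

/-! ### §4 Van Geemen's general member (`K` imaginary quadratic, `Hg = SU_H`, `n ≥ 2`): `Hg′(A) ⊊ S(A)`, `Hg(A) ⊊ L(A)` -/

namespace Literature.AlgebraicGeometry.VanGeemen1994

section Quadratic

variable (A : AbelianVariety ℂ) (φ : A ⟶ A) (n d : ℕ) (e : ProjectiveEmbedding A.X)
  (a : complexBetti (projectiveSpace e.n ℂ) 2) {C : AbelianVariety ℂ}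

/-- **Milne's Prop. 4.8 (c) FAILS for van Geemen's general Weil-type abelian variety: `Hg′(A) ≠ S(A)`** (`Hg = SU_H`,
`n ≥ 2`; exotic classes `W_K`, tree `not_isDivisorGenerated_of_hasHodgeGroupSU`, and Milne's Cor. 4.5, the tree's record
`Milne1999_specialLefschetzGroup_invariants_le_holds`). [cite: Milne1999LefschetzClasses, Cor. 4.5 and Prop. 4.8 (p. 660)]
[cite: vanGeemen1994HodgeAV, Thm. 4.11, 6.11 and 6.12] -/
theorem hodgeGroup_ne_specialLefschetzGroup_of_hasHodgeGroupSU (hn : 2 ≤ n) (hd : 0 < d) (hA : A.dim = 2 * n)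
    (hφ : φ ≫ φ = -(d • 𝟙 A)) (ha : IsRationalClass a) (ha0 : a ≠ 0) (hSU : HasHodgeGroupSU A φ n d (hK d φ e a)) :
    hodgeGroup A.dim A.X ≠ specialLefschetzGroup A.dim A.X :=
  AbelianVariety.hodgeGroup_ne_specialLefschetzGroup_of_not_isDivisorGenerated _
    Milne1999_specialLefschetzGroup_invariants_le_holds
    (not_isDivisorGenerated_of_hasHodgeGroupSU A φ n d e a hn hd hA hφ ha ha0 hSU)

/-- **`Hg′(A) ⊊ S(A)`** for van Geemen's general member. [cite: Milne1999LefschetzClasses, §4 p. 660 and Prop. 4.8]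
[cite: vanGeemen1994HodgeAV, Thm. 6.11 and 6.12] -/
theorem hodgeGroup_lt_specialLefschetzGroup_of_hasHodgeGroupSU (hn : 2 ≤ n) (hd : 0 < d) (hA : A.dim = 2 * n)
    (hφ : φ ≫ φ = -(d • 𝟙 A)) (ha : IsRationalClass a) (ha0 : a ≠ 0) (hSU : HasHodgeGroupSU A φ n d (hK d φ e a)) :
    hodgeGroup A.dim A.X < specialLefschetzGroup A.dim A.X :=
  lt_of_le_of_ne (AbelianVariety.hodgeGroup_le_specialLefschetzGroup A).1
    (hodgeGroup_ne_specialLefschetzGroup_of_hasHodgeGroupSU A φ n d e a hn hd hA hφ ha ha0 hSU)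

/-- **Milne's Prop. 4.8 (b) FAILS for van Geemen's general member: `Hg(A) ≠ L(A)`.**
[cite: Milne1999LefschetzClasses, Prop. 4.8 (p. 660)] [cite: vanGeemen1994HodgeAV, Thm. 6.11 and 6.12] -/
theorem mumfordTateGroup_ne_lefschetzGroup_of_hasHodgeGroupSU (hn : 2 ≤ n) (hd : 0 < d) (hA : A.dim = 2 * n)
    (hφ : φ ≫ φ = -(d • 𝟙 A)) (ha : IsRationalClass a) (ha0 : a ≠ 0) (hSU : HasHodgeGroupSU A φ n d (hK d φ e a)) :
    mumfordTateGroup A.dim A.X ≠ lefschetzGroup A.dim A.X :=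
  fun heq ↦ hodgeGroup_ne_specialLefschetzGroup_of_hasHodgeGroupSU A φ n d e a hn hd hA hφ ha ha0 hSU
    ((AbelianVariety.hodgeGroup_eq_specialLefschetzGroup_iff A (by omega : 1 ≤ A.dim)).2 heq)

/-- **`Hg(A) ⊊ L(A)`** for van Geemen's general member. [cite: Milne1999LefschetzClasses, §4 p. 660 and Prop. 4.8]
[cite: vanGeemen1994HodgeAV, Thm. 6.11 and 6.12] -/
theorem mumfordTateGroup_lt_lefschetzGroup_of_hasHodgeGroupSU (hn : 2 ≤ n) (hd : 0 < d) (hA : A.dim = 2 * n)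
    (hφ : φ ≫ φ = -(d • 𝟙 A)) (ha : IsRationalClass a) (ha0 : a ≠ 0) (hSU : HasHodgeGroupSU A φ n d (hK d φ e a)) :
    mumfordTateGroup A.dim A.X < lefschetzGroup A.dim A.X :=
  lt_of_le_of_ne (AbelianVariety.hodgeGroup_le_specialLefschetzGroup A).2
    (mumfordTateGroup_ne_lefschetzGroup_of_hasHodgeGroupSU A φ n d e a hn hd hA hφ ha ha0 hSU)

/-- **On every power: `Hg′(A^{N+1}) ≠ S(A^{N+1})`** for van Geemen's general member.
[cite: Milne1999LefschetzClasses, Cor. 4.7 and Prop. 4.8] [cite: vanGeemen1994HodgeAV, Thm. 6.12] -/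
theorem hodgeGroup_powSucc_ne_specialLefschetzGroup_of_hasHodgeGroupSU (hn : 2 ≤ n) (hd : 0 < d)
    (hA : A.dim = 2 * n) (hφ : φ ≫ φ = -(d • 𝟙 A)) (ha : IsRationalClass a) (ha0 : a ≠ 0)
    (hSU : HasHodgeGroupSU A φ n d (hK d φ e a)) (N : ℕ) :
    hodgeGroup (A.powSucc N).dim (A.powSucc N).X ≠ specialLefschetzGroup (A.powSucc N).dim (A.powSucc N).X :=
  AbelianVariety.hodgeGroup_ne_specialLefschetzGroup_of_not_isDivisorGenerated _
    Milne1999_specialLefschetzGroup_invariants_le_holds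
    (not_isDivisorGenerated_powSucc_of_hasHodgeGroupSU A φ n d e a hn hd hA hφ ha ha0 hSU N)

/-- **On the isogeny class: `Hg′(C) ≠ S(C)`** for `C` isogenous to van Geemen's general member.
[cite: Milne1999LefschetzClasses, §1 p. 644, Cor. 4.5 and Prop. 4.8] [cite: vanGeemen1994HodgeAV, 3.6 (p. 236) and Thm. 6.12] -/
theorem hodgeGroup_ne_specialLefschetzGroup_of_isIsogenous_of_hasHodgeGroupSU (hn : 2 ≤ n) (hd : 0 < d)
    (hA : A.dim = 2 * n) (hφ : φ ≫ φ = -(d • 𝟙 A)) (ha : IsRationalClass a) (ha0 : a ≠ 0)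
    (hSU : HasHodgeGroupSU A φ n d (hK d φ e a)) (hC : AbelianVariety.IsIsogenous C A) :
    hodgeGroup C.dim C.X ≠ specialLefschetzGroup C.dim C.X :=
  AbelianVariety.hodgeGroup_ne_specialLefschetzGroup_of_not_isDivisorGenerated _
    Milne1999_specialLefschetzGroup_invariants_le_holds
    (not_isDivisorGenerated_of_isIsogenous_of_hasHodgeGroupSU A φ n d e a hn hd hA hφ ha ha0 hSU hC)

end Quadratic

end Literature.AlgebraicGeometry.VanGeemen1994

end
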